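import Summits.CriticalPhenomena.PercolationContinuityZ3.Theorems.Transplant.SkelPhiFaceNumsYRun
import Summits.CriticalPhenomena.PercolationContinuityZ3.Theorems.Transplant.SkelPhiFaceNumsXRun
import Summits.CriticalPhenomena.PercolationContinuityZ3.Theorems.Transplant.SkelPhiFaceSchedBoxes
import HarnessLib

/-!
# N1 ({±1} node), (F) inner route, part R5b-yface (hp-8 g33): **THE y′-FACE FOOTPRINTS FROM LINEAR FLOORS** — the y′-face mirrors of
# `xRun_footprint_of_floors` / `yRun_footprint_of_floors` / `lastCore_target_of_floors`: for a y′-face (`du.1 = 1`) the along habitat is on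
# axis `1` (levels) and the transverse one on axis `0`; the along run is the y′-run read with the face sign `σ`, the tangential run is an
# x-run read with `σT`, and the target box sits on the x-run's last core (uncorrelated box).
builds on p205010 (kernel theorem, internal audit signed; external expert review pending) — nothing in this file uses p205010; no claim about the open node.
Lane `prim-bschramm`, seat `prim-hp-8` (gen 33); helper file (`--supports stmt-CriticalPhenomena-4575 --as helper`).
* `Skelφ.xSLo/xSHi` (signed along ends of the x-run's region), **`yRun_footprint_of_floors_yface`** (along y′-run), **`xRun_footprint_of_floors_yface`**
  (tangential x-run), `xCoreB`, **`lastCoreX_target_of_floors`** (target box on the x-run's last core).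
[cite: KozmaNitzan2024, §4 Lemma 11 (pp. 22–23), Lemma 12 (pp. 23–25)] [cite: MartineauTassion2017, §4.1, §4.3 Lemma 4.2]
-/

namespace Summit.CriticalPhenomena.PercolationContinuityZ3.Theorems.Transplant

namespace Skelφ

open Literature.Probability.Percolation Literature.Probability.LatticeModels
open Literature.Probability.Percolation.KozmaNitzan.Cells (oth oth_ne sgOf sgOf_sign eq_oth_of_ne oth_oth)
open ChainPlanar ChainPara
open TwoAxis.Para (modulus coarse lam0 lam1)

/-- **THE ALONG y′-RUN OF A y′-FACE FROM LINEAR FLOORS** (`du.1 = 1`; read with the face sign `σ = sgOf du`): fields `paLo…/PLO/PHI, hreg,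
hP0–hP3, hPf₁₂₃` of `FaceRunNums3 … false …` — the along habitat (axis `1`) from the level readings, the transverse one (axis `0`) from the
correlated α-readings. [cite: KozmaNitzan2024, §4 Lemma 11 (pp. 22–23)] -/
theorem yRun_footprint_of_floors_yface {A vα vβ c₀ c₁ D κ₀ κ₁ mod : ℤ} {n : ℕ} (hn : 1 ≤ n) {h : ℤ} (hA : 0 < A) (hκ₀ : 0 ≤ κ₀)
    (hc0 : c₀ = A * κ₀) (hc1 : c₁ = A * κ₁) (hmod : modulus n h vα vβ = mod) (hmod0 : 0 < mod) (hD : D = A ^ 2 * mod) (hv : |vα| ≤ n)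
    {ℓ : ℕ} (hlay : (n + h.natAbs : ℕ) ≤ (n : ℤ) * ℓ + 1) (hmodlo : (n : ℤ) * ℓ - (shearUnit n h : ℤ) + 1 ≤ mod) (hmodhi : mod ≤ (n : ℤ) * ℓ)
    (yL : Site 2) (du : MDir) (hdu : du.1 = 1) (R' q N : ℕ) {flo fhi fw : ℤ}
    (FA1 : sgOf du = 1 → ∀ k ≤ N, mod * (flo - coarse c₁ (D / 2) D (lam1 A n h yL)) ≤ κ₁ * ((shearUnit n h : ℤ) * (ySLo n ℓ h q R' 1 k - 1)) - mod + 1)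
    (FA2 : sgOf du = 1 → ∀ k ≤ N, mod * (coarse c₁ (D / 2) D (lam1 A n h yL) + 1) + κ₁ * ((shearUnit n h : ℤ) * ySHi n ℓ h q R' 1 k + shearUnit n h - 1) ≤
      mod * fhi)
    (FA3 : sgOf du = -1 → ∀ k ≤ N, mod * (flo + coarse c₁ (D / 2) D (lam1 A n h yL) + 1) ≤ -(κ₁ * ((shearUnit n h : ℤ) * ySHi n ℓ h q R' (-1) k + shearUnit n h - 1)))
    (FA4 : sgOf du = -1 → ∀ k ≤ N, -(mod * coarse c₁ (D / 2) D (lam1 A n h yL)) - κ₁ * ((shearUnit n h : ℤ) * (ySLo n ℓ h q R' (-1) k - 1)) + mod - 1 ≤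
      mod * fhi)
    (FA5 : ∀ k ≤ N, (n : ℤ) * mod * (-fw - coarse c₀ (D / 2) D (lam0 A vα vβ yL)) ≤ -(κ₀ * (yBnd n ℓ h mod q R' k + 2 * n)) - n * mod)
    (FA6 : ∀ k ≤ N, (n : ℤ) * mod * (coarse c₀ (D / 2) D (lam0 A vα vβ yL) + 1) + κ₀ * (yBnd n ℓ h mod q R' k + n) ≤ n * mod * fw) :
    ∃ (PLO PHI : ℕ → Site 2),
      (∀ k ≤ N, (yRunSched hn hv hlay R' q N).region k ⊆
        Finset.Icc (pt (yBoxLoS n ℓ h q R' k) (yBoxLoT n vα R' k)) (pt (yBoxHiS n ℓ h q R' k) (yBoxHiT n vα R' k))) ∧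
      (∀ k ≤ N, PLO k 0 ≤ coarse c₀ (D / 2) D (lam0 A vα vβ yL) +
        (c₀ * (A * (modulus n h vα vβ * (min (sgOf du * yBoxLoT n vα R' k) (sgOf du * yBoxHiT n vα R' k)) -
          max (vα * ((shearUnit n h : ℤ) * (min (sgOf du * yBoxLoS n ℓ h q R' k) (sgOf du * yBoxHiS n ℓ h q R' k) - 1)))
            (vα * ((shearUnit n h : ℤ) * (max (sgOf du * yBoxLoS n ℓ h q R' k) (sgOf du * yBoxHiS n ℓ h q R' k)) + shearUnit n h - 1))) / n)) / D) ∧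
      (∀ k ≤ N, coarse c₀ (D / 2) D (lam0 A vα vβ yL) +
        (c₀ * (A * (modulus n h vα vβ * (max (sgOf du * yBoxLoT n vα R' k) (sgOf du * yBoxHiT n vα R' k)) -
          min (vα * ((shearUnit n h : ℤ) * (min (sgOf du * yBoxLoS n ℓ h q R' k) (sgOf du * yBoxHiS n ℓ h q R' k) - 1)))
            (vα * ((shearUnit n h : ℤ) * (max (sgOf du * yBoxLoS n ℓ h q R' k) (sgOf du * yBoxHiS n ℓ h q R' k)) + shearUnit n h - 1))) / n)) / D + 1 ≤ PHI k 0) ∧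
      (∀ k ≤ N, PLO k 1 ≤ coarse c₁ (D / 2) D (lam1 A n h yL) +
        (c₁ * (A * ((shearUnit n h : ℤ) * (min (sgOf du * yBoxLoS n ℓ h q R' k) (sgOf du * yBoxHiS n ℓ h q R' k) - 1)))) / D) ∧
      (∀ k ≤ N, coarse c₁ (D / 2) D (lam1 A n h yL) +
        (c₁ * (A * ((shearUnit n h : ℤ) * (max (sgOf du * yBoxLoS n ℓ h q R' k) (sgOf du * yBoxHiS n ℓ h q R' k)) + shearUnit n h - 1))) / D + 1 ≤ PHI k 1) ∧
      (∀ k ≤ N, sgOf du = 1 → flo ≤ PLO k du.1 ∧ PHI k du.1 ≤ fhi) ∧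
      (∀ k ≤ N, sgOf du = -1 → flo ≤ -PHI k du.1 ∧ -PLO k du.1 ≤ fhi) ∧
      (∀ k ≤ N, -fw ≤ PLO k (oth du.1) ∧ PHI k (oth du.1) ≤ fw) := by
  set f₀ := coarse c₀ (D / 2) D (lam0 A vα vβ yL) with hf₀
  set f₁ := coarse c₁ (D / 2) D (lam1 A n h yL) with hf₁
  set U : ℤ := (shearUnit n h : ℤ) with hU
  have hn0 : (0 : ℤ) < n := by exact_mod_cast hn
  have hnm : 0 < (n : ℤ) * mod := mul_pos hn0 hmod0
  have hσ : sgOf du = 1 ∨ sgOf du = -1 := sgOf_sign du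
  set τ := sgOf du with hτ
  set sL := yBoxLoS n ℓ h q R' with hsL
  set sH := yBoxHiS n ℓ h q R' with hsH
  set tL := yBoxLoT n vα R' with htL
  set tH := yBoxHiT n vα R' with htH
  have hmsMs : ∀ k, min (τ * sL k) (τ * sH k) ≤ max (τ * sL k) (τ * sH k) + 1 := fun k => by linarith [min_le_max (a := τ * sL k) (b := τ * sH k)]
  have hcorr : ∀ k (m : ℤ), (m = min (τ * tL k) (τ * tH k) ∨ m = max (τ * tL k) (τ * tH k)) →
      ∀ L : ℤ, min (τ * sL k) (τ * sH k) - 1 ≤ L → L ≤ max (τ * sL k) (τ * sH k) + 1 → |mod * m - vα * (U * L)| ≤ yBnd n ℓ h mod q R' k := by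
    intro k m hm L hL1 hL2
    refine yRun_corr hn hv hmod0 hmodlo hmodhi hσ q R' k ?_ ?_ hL1 hL2
    · rcases hm with rfl | rfl
      · exact le_rfl
      · exact min_le_max
    · rcases hm with rfl | rfl
      · exact min_le_max
      · exact le_rfl
  let X0lo : ℕ → ℤ := fun k => (c₀ * (A * (modulus n h vα vβ * (min (τ * tL k) (τ * tH k)) -
      max (vα * (U * (min (τ * sL k) (τ * sH k) - 1))) (vα * (U * (max (τ * sL k) (τ * sH k)) + U - 1))) / n)) / D
  let X0hi : ℕ → ℤ := fun k => (c₀ * (A * (modulus n h vα vβ * (max (τ * tL k) (τ * tH k)) -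
      min (vα * (U * (min (τ * sL k) (τ * sH k) - 1))) (vα * (U * (max (τ * sL k) (τ * sH k)) + U - 1))) / n)) / D
  let X1lo : ℕ → ℤ := fun k => (c₁ * (A * (U * (min (τ * sL k) (τ * sH k) - 1)))) / D
  let X1hi : ℕ → ℤ := fun k => (c₁ * (A * (U * (max (τ * sL k) (τ * sH k)) + U - 1))) / D
  refine ⟨fun k => pt (f₀ + X0lo k) (f₁ + X1lo k), fun k => pt (f₀ + X0hi k + 1) (f₁ + X1hi k + 1),
    fun k _ => yRunSched_region_subset_yBox hn hv hlay R' q N k, fun k _ => le_of_eq (pt_zero _ _), fun k _ => le_of_eq (pt_zero _ _).symm,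
    fun k _ => le_of_eq (pt_one _ _), fun k _ => le_of_eq (pt_one _ _).symm, ?_, ?_, ?_⟩
  · -- σ = 1: along = axis 1 (levels)
    intro k hk h1
    rw [hdu]; simp only [pt_one]
    obtain ⟨⟨hlo, -⟩, -, hhi⟩ := read1_gen_bounds (U := U) (κ₁ := κ₁) hA hmod0 hc1 hD (min (τ * sL k) (τ * sH k)) (max (τ * sL k) (τ * sH k))
    have f1 := FA1 h1 k hk
    have f2 := FA2 h1 k hk
    simp only [ySLo, ySHi, one_mul, ← hsL, ← hsH] at f1 f2
    have hτ1 : τ = 1 := h1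
    simp only [hτ1, one_mul] at hlo hhi ⊢
    constructor
    · exact le_of_mul_le_mul_left (by simp only [X1lo, hτ1, one_mul]; linarith) hmod0
    · exact le_of_mul_le_mul_left (by simp only [X1hi, hτ1, one_mul]; linarith) hmod0
  · -- σ = −1
    intro k hk h1
    rw [hdu]; simp only [pt_one]
    obtain ⟨⟨hlo, -⟩, -, hhi⟩ := read1_gen_bounds (U := U) (κ₁ := κ₁) hA hmod0 hc1 hD (min (τ * sL k) (τ * sH k)) (max (τ * sL k) (τ * sH k))
    have f3 := FA3 h1 k hk
    have f4 := FA4 h1 k hk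
    simp only [ySLo, ySHi, ← hsL, ← hsH] at f3 f4
    have hτ1 : τ = -1 := h1
    simp only [hτ1] at hlo hhi ⊢
    constructor
    · exact le_of_mul_le_mul_left (by simp only [X1hi, hτ1]; linarith) hmod0
    · exact le_of_mul_le_mul_left (by simp only [X1lo, hτ1]; linarith) hmod0
  · -- transverse = axis 0 (correlated)
    intro k hk
    rw [hdu, show oth (1 : Fin 2) = 0 from rfl]; simp only [pt_zero]
    have hlo := (read0_corr_lo_bounds (U := U) hA hκ₀ hmod0 hn0 hc0 hD hv (hmsMs k) (hcorr k _ (Or.inl rfl))).1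
    have hhi := (read0_corr_hi_bounds (U := U) hA hκ₀ hmod0 hn0 hc0 hD hv (hmsMs k) (hcorr k _ (Or.inr rfl))).2
    have f5 := FA5 k hk
    have f6 := FA6 k hk
    constructor
    · show -fw ≤ f₀ + X0lo k
      have e : X0lo k = (c₀ * (A * (mod * (min (τ * tL k) (τ * tH k)) -
          max (vα * (U * (min (τ * sL k) (τ * sH k) - 1))) (vα * (U * (max (τ * sL k) (τ * sH k)) + U - 1))) / n)) / D := by
        simp only [X0lo, hmod]
      rw [e]
      exact le_of_mul_le_mul_left (by linarith) hnm
    · show f₀ + X0hi k + 1 ≤ fw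
      have e : X0hi k = (c₀ * (A * (mod * (max (τ * tL k) (τ * tH k)) -
          min (vα * (U * (min (τ * sL k) (τ * sH k) - 1))) (vα * (U * (max (τ * sL k) (τ * sH k)) + U - 1))) / n)) / D := by
        simp only [X0hi, hmod]
      rw [e]
      exact le_of_mul_le_mul_left (by linarith) hnm

/-- Signed along ends of region `k` of the x-run: `min/max(τ·xBoxLoA, τ·xBoxHiA)`. [folklore] -/
def xSLo (n q R' : ℕ) (τ : ℤ) (k : ℕ) : ℤ := min (τ * xBoxLoA n q R' k) (τ * xBoxHiA n q R' k)
/-- see `xSLo`. [folklore] -/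
def xSHi (n q R' : ℕ) (τ : ℤ) (k : ℕ) : ℤ := max (τ * xBoxLoA n q R' k) (τ * xBoxHiA n q R' k)

/-- **THE TANGENTIAL x-RUN OF A y′-FACE FROM LINEAR FLOORS** (`du.1 = 1`; read with `τ = σT`, habitat sign `σ = sgOf du`): fields
`yaLo…/YLO/YHI, hregY, hY0–hY3, hYf₁₂₃` of `FaceRunNums3 … false …`. [cite: KozmaNitzan2024, §4 Lemma 12 (pp. 23–25)] -/
theorem xRun_footprint_of_floors_yface {A vα vβ c₀ c₁ D κ₀ κ₁ mod : ℤ} {n : ℕ} (hn : 1 ≤ n) (h : ℤ) (hA : 0 < A) (hκ₀ : 0 ≤ κ₀)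
    (hc0 : c₀ = A * κ₀) (hc1 : c₁ = A * κ₁) (hmod : modulus n h vα vβ = mod) (hmod0 : 0 < mod) (hD : D = A ^ 2 * mod) {Vb : ℤ} (hv : |vα| ≤ Vb)
    (yT : Site 2) {τ : ℤ} (hτ : τ = 1 ∨ τ = -1) (du : MDir) (hdu : du.1 = 1) (ℓ R' q N : ℕ) {flo fhi fw : ℤ}
    (FT1 : sgOf du = 1 → ∀ k ≤ N, mod * (flo - coarse c₁ (D / 2) D (lam1 A n h yT)) ≤ -(κ₁ * (shearUnit n h : ℤ) * (xBoxB n ℓ h R' k + 1)) - mod + 1)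
    (FT2 : sgOf du = 1 → ∀ k ≤ N, mod * (coarse c₁ (D / 2) D (lam1 A n h yT) + 1) + κ₁ * ((shearUnit n h : ℤ) * xBoxB n ℓ h R' k + shearUnit n h - 1) ≤ mod * fhi)
    (FT3 : sgOf du = -1 → ∀ k ≤ N, mod * (flo + coarse c₁ (D / 2) D (lam1 A n h yT) + 1) ≤ -(κ₁ * ((shearUnit n h : ℤ) * xBoxB n ℓ h R' k + shearUnit n h - 1)))
    (FT4 : sgOf du = -1 → ∀ k ≤ N, -(mod * coarse c₁ (D / 2) D (lam1 A n h yT)) + κ₁ * (shearUnit n h : ℤ) * (xBoxB n ℓ h R' k + 1) + mod - 1 ≤ mod * fhi)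
    (FT5 : ∀ k ≤ N, (n : ℤ) * mod * (-fw - coarse c₀ (D / 2) D (lam0 A vα vβ yT)) ≤
      κ₀ * mod * xSLo n q R' τ k - κ₀ * Vb * (shearUnit n h : ℤ) * (xBoxB n ℓ h R' k + 1) - κ₀ * n - n * mod)
    (FT6 : ∀ k ≤ N, (n : ℤ) * mod * (coarse c₀ (D / 2) D (lam0 A vα vβ yT) + 1) + κ₀ * mod * xSHi n q R' τ k +
      κ₀ * Vb * (shearUnit n h : ℤ) * (xBoxB n ℓ h R' k + 1) ≤ n * mod * fw) :
    ∃ (YLO YHI : ℕ → Site 2),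
      (∀ k ≤ N, (xRunSched n ℓ h R' q N).region k ⊆
        Finset.Icc (pt (xBoxLoA n q R' k) (-xBoxB n ℓ h R' k)) (pt (xBoxHiA n q R' k) (xBoxB n ℓ h R' k))) ∧
      (∀ k ≤ N, YLO k 0 ≤ coarse c₀ (D / 2) D (lam0 A vα vβ yT) +
        (c₀ * (A * (modulus n h vα vβ * (min (τ * xBoxLoA n q R' k) (τ * xBoxHiA n q R' k)) -
          max (vα * ((shearUnit n h : ℤ) * (min (τ * -xBoxB n ℓ h R' k) (τ * xBoxB n ℓ h R' k) - 1)))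
            (vα * ((shearUnit n h : ℤ) * (max (τ * -xBoxB n ℓ h R' k) (τ * xBoxB n ℓ h R' k)) + shearUnit n h - 1))) / n)) / D) ∧
      (∀ k ≤ N, coarse c₀ (D / 2) D (lam0 A vα vβ yT) +
        (c₀ * (A * (modulus n h vα vβ * (max (τ * xBoxLoA n q R' k) (τ * xBoxHiA n q R' k)) -
          min (vα * ((shearUnit n h : ℤ) * (min (τ * -xBoxB n ℓ h R' k) (τ * xBoxB n ℓ h R' k) - 1)))
            (vα * ((shearUnit n h : ℤ) * (max (τ * -xBoxB n ℓ h R' k) (τ * xBoxB n ℓ h R' k)) + shearUnit n h - 1))) / n)) / D + 1 ≤ YHI k 0) ∧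
      (∀ k ≤ N, YLO k 1 ≤ coarse c₁ (D / 2) D (lam1 A n h yT) +
        (c₁ * (A * ((shearUnit n h : ℤ) * (min (τ * -xBoxB n ℓ h R' k) (τ * xBoxB n ℓ h R' k) - 1)))) / D) ∧
      (∀ k ≤ N, coarse c₁ (D / 2) D (lam1 A n h yT) +
        (c₁ * (A * ((shearUnit n h : ℤ) * (max (τ * -xBoxB n ℓ h R' k) (τ * xBoxB n ℓ h R' k)) + shearUnit n h - 1))) / D + 1 ≤ YHI k 1) ∧
      (∀ k ≤ N, sgOf du = 1 → flo ≤ YLO k du.1 ∧ YHI k du.1 ≤ fhi) ∧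
      (∀ k ≤ N, sgOf du = -1 → flo ≤ -YHI k du.1 ∧ -YLO k du.1 ≤ fhi) ∧
      (∀ k ≤ N, -fw ≤ YLO k (oth du.1) ∧ YHI k (oth du.1) ≤ fw) := by
  set f₀ := coarse c₀ (D / 2) D (lam0 A vα vβ yT) with hf₀
  set f₁ := coarse c₁ (D / 2) D (lam1 A n h yT) with hf₁
  set U : ℤ := (shearUnit n h : ℤ) with hU
  have hU1 : 1 ≤ U := by rw [hU]; exact_mod_cast (show 1 ≤ shearUnit n h by unfold shearUnit; omega)
  have hn0 : (0 : ℤ) < n := by exact_mod_cast hn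
  have hnm : 0 < (n : ℤ) * mod := mul_pos hn0 hmod0
  set aL := xBoxLoA n q R' with haL
  set aH := xBoxHiA n q R' with haH
  set Bk := xBoxB n ℓ h R' with hBk
  have hB0 : ∀ k, 0 ≤ Bk k := fun k => xBoxB_nonneg n ℓ h R' k
  have hmb : ∀ k, min (τ * -Bk k) (τ * Bk k) = -Bk k := fun k => by
    rcases hτ with h1 | h1
    · rw [h1, one_mul, one_mul]; exact min_eq_left (by linarith [hB0 k])
    · rw [h1, neg_one_mul, neg_one_mul, neg_neg]; exact min_eq_right (by linarith [hB0 k])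
  have hMb : ∀ k, max (τ * -Bk k) (τ * Bk k) = Bk k := fun k => by
    rcases hτ with h1 | h1
    · rw [h1, one_mul, one_mul]; exact max_eq_right (by linarith [hB0 k])
    · rw [h1, neg_one_mul, neg_one_mul, neg_neg]; exact max_eq_left (by linarith [hB0 k])
  let X0lo : ℕ → ℤ := fun k => (c₀ * (A * (modulus n h vα vβ * (min (τ * aL k) (τ * aH k)) -
      max (vα * (U * (min (τ * -Bk k) (τ * Bk k) - 1))) (vα * (U * (max (τ * -Bk k) (τ * Bk k)) + U - 1))) / n)) / D
  let X0hi : ℕ → ℤ := fun k => (c₀ * (A * (modulus n h vα vβ * (max (τ * aL k) (τ * aH k)) -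
      min (vα * (U * (min (τ * -Bk k) (τ * Bk k) - 1))) (vα * (U * (max (τ * -Bk k) (τ * Bk k)) + U - 1))) / n)) / D
  let X1lo : ℕ → ℤ := fun k => (c₁ * (A * (U * (min (τ * -Bk k) (τ * Bk k) - 1)))) / D
  let X1hi : ℕ → ℤ := fun k => (c₁ * (A * (U * (max (τ * -Bk k) (τ * Bk k)) + U - 1))) / D
  refine ⟨fun k => pt (f₀ + X0lo k) (f₁ + X1lo k), fun k => pt (f₀ + X0hi k + 1) (f₁ + X1hi k + 1),
    fun k _ => xRunSched_region_subset_xBox n ℓ h R' q N k, fun k _ => le_of_eq (pt_zero _ _), fun k _ => le_of_eq (pt_zero _ _).symm,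
    fun k _ => le_of_eq (pt_one _ _), fun k _ => le_of_eq (pt_one _ _).symm, ?_, ?_, ?_⟩
  · -- σ = 1: along habitat on axis 1 from the level box ±B
    intro k hk h1
    rw [hdu]; simp only [pt_one]
    have hlo := (read1_lo_bounds (U := U) (κ₁ := κ₁) hA hmod0 hc1 hD (Bk k)).1
    have hhi := (read1_hi_bounds (U := U) (κ₁ := κ₁) hA hmod0 hc1 hD (Bk k)).2
    have f1 := FT1 h1 k hk
    have f2 := FT2 h1 k hk
    constructor
    · show flo ≤ f₁ + X1lo k
      have e : X1lo k = (c₁ * (A * (U * (-Bk k - 1)))) / D := by simp only [X1lo, hmb]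
      rw [e]; exact le_of_mul_le_mul_left (by linarith) hmod0
    · show f₁ + X1hi k + 1 ≤ fhi
      have e : X1hi k = (c₁ * (A * (U * Bk k + U - 1))) / D := by simp only [X1hi, hMb]
      rw [e]; exact le_of_mul_le_mul_left (by linarith) hmod0
  · -- σ = −1
    intro k hk h1
    rw [hdu]; simp only [pt_one]
    have hlo := (read1_lo_bounds (U := U) (κ₁ := κ₁) hA hmod0 hc1 hD (Bk k)).1
    have hhi := (read1_hi_bounds (U := U) (κ₁ := κ₁) hA hmod0 hc1 hD (Bk k)).2
    have f3 := FT3 h1 k hk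
    have f4 := FT4 h1 k hk
    constructor
    · show flo ≤ -(f₁ + X1hi k + 1)
      have e : X1hi k = (c₁ * (A * (U * Bk k + U - 1))) / D := by simp only [X1hi, hMb]
      rw [e]
      have : f₁ + (c₁ * (A * (U * Bk k + U - 1))) / D + 1 ≤ -flo := le_of_mul_le_mul_left (by linarith) hmod0
      linarith
    · show -(f₁ + X1lo k) ≤ fhi
      have e : X1lo k = (c₁ * (A * (U * (-Bk k - 1)))) / D := by simp only [X1lo, hmb]
      rw [e]
      have : -fhi ≤ f₁ + (c₁ * (A * (U * (-Bk k - 1)))) / D := le_of_mul_le_mul_left (by linarith) hmod0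
      linarith
  · -- transverse habitat on axis 0 from the along box (signed)
    intro k hk
    rw [hdu, show oth (1 : Fin 2) = 0 from rfl]; simp only [pt_zero]
    have hlo := (read0_lo_bounds (U := U) hA hκ₀ hmod0 hn0 hc0 hD hv hU1 (hB0 k) (min (τ * aL k) (τ * aH k))).1
    have hhi := (read0_hi_bounds (U := U) hA hκ₀ hmod0 hn0 hc0 hD hv hU1 (hB0 k) (max (τ * aL k) (τ * aH k))).2
    have f5 := FT5 k hk
    have f6 := FT6 k hk
    simp only [xSLo, xSHi, ← haL, ← haH] at f5 f6
    constructor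
    · show -fw ≤ f₀ + X0lo k
      have e : X0lo k = (c₀ * (A * (mod * (min (τ * aL k) (τ * aH k)) - max (vα * (U * (-Bk k - 1))) (vα * (U * Bk k + U - 1))) / n)) / D := by
        simp only [X0lo, hmod, hmb, hMb]
      rw [e]; exact le_of_mul_le_mul_left (by linarith) hnm
    · show f₀ + X0hi k + 1 ≤ fw
      have e : X0hi k = (c₀ * (A * (mod * (max (τ * aL k) (τ * aH k)) - min (vα * (U * (-Bk k - 1))) (vα * (U * Bk k + U - 1))) / n)) / D := by
        simp only [X0hi, hmod, hmb, hMb]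
      rw [e]; exact le_of_mul_le_mul_left (by linarith) hnm

/-- Level half-height of the x-run's core `k`: `W + k·R′`. [folklore] -/
def xCoreB (n ℓ : ℕ) (h : ℤ) (R' : ℕ) (k : ℕ) : ℤ := ((n * ℓ / shearUnit n h + 1 : ℕ) : ℤ) + (k : ℤ) * R'

/-- Signed along ends of the x-run's core `k`: `min/max(τ·(k n − q − kR′), τ·(k n + q + kR′))`. [folklore] -/
def xCSLo (n q R' : ℕ) (τ : ℤ) (k : ℕ) : ℤ := min (τ * ((k : ℤ) * n - q - (k : ℤ) * R')) (τ * ((k : ℤ) * n + q + (k : ℤ) * R'))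
/-- see `xCSLo`. [folklore] -/
def xCSHi (n q R' : ℕ) (τ : ℤ) (k : ℕ) : ℤ := max (τ * ((k : ℤ) * n - q - (k : ℤ) * R')) (τ * ((k : ℤ) * n + q + (k : ℤ) * R'))

/-- **THE TARGET CELL BOX ON THE x-RUN'S LAST CORE FROM LINEAR FLOORS** (y′-face: the tangential x-run's core `N+1`, read with `τ = σT` at
`yT`): fields `laLo…/LLO/LHI, hlastc, hL0–hL3, hglo, hghi` of `FaceRunNums3 … false …`/`faceRunNums3_y_mk` from four linear floors.
[cite: KozmaNitzan2024, §4 Lemma 12 (pp. 23–25)] -/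
theorem lastCoreX_target_of_floors {A vα vβ c₀ c₁ D κ₀ κ₁ mod : ℤ} {n : ℕ} (hn : 1 ≤ n) (h : ℤ) (hA : 0 < A) (hκ₀ : 0 ≤ κ₀)
    (hc0 : c₀ = A * κ₀) (hc1 : c₁ = A * κ₁) (hmod : modulus n h vα vβ = mod) (hmod0 : 0 < mod) (hD : D = A ^ 2 * mod) {Vb : ℤ} (hv : |vα| ≤ Vb)
    (yT : Site 2) {τ : ℤ} (hτ : τ = 1 ∨ τ = -1) (ℓ R' q N : ℕ) (z cen' : Site 2) (b₀ : Fin 2 → ℕ)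
    (FL1 : (n : ℤ) * mod * (cen' 0 - b₀ 0 + 2 - z 0 - coarse c₀ (D / 2) D (lam0 A vα vβ yT)) ≤
      κ₀ * mod * xCSLo n q R' τ (N + 1) - κ₀ * Vb * (shearUnit n h : ℤ) * (xCoreB n ℓ h R' (N + 1) + 1) - κ₀ * n - n * mod)
    (FL2 : (n : ℤ) * mod * (coarse c₀ (D / 2) D (lam0 A vα vβ yT) + 1) + κ₀ * mod * xCSHi n q R' τ (N + 1) +
      κ₀ * Vb * (shearUnit n h : ℤ) * (xCoreB n ℓ h R' (N + 1) + 1) ≤ n * mod * (cen' 0 + b₀ 0 - 2 - z 0))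
    (FL3 : mod * (cen' 1 - b₀ 1 + 2 - z 1 - coarse c₁ (D / 2) D (lam1 A n h yT)) ≤ -(κ₁ * (shearUnit n h : ℤ) * (xCoreB n ℓ h R' (N + 1) + 1)) - mod + 1)
    (FL4 : mod * (coarse c₁ (D / 2) D (lam1 A n h yT) + 1) + κ₁ * ((shearUnit n h : ℤ) * xCoreB n ℓ h R' (N + 1) + shearUnit n h - 1) ≤
      mod * (cen' 1 + b₀ 1 - 2 - z 1)) :
    ∃ (LLO LHI : Site 2),
      (xRunSched n ℓ h R' q N).core (N + 1) ⊆ Finset.Icc (pt ((((N + 1 : ℕ) : ℤ)) * n - q - (((N + 1 : ℕ) : ℤ)) * R') (-xCoreB n ℓ h R' (N + 1)))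
        (pt ((((N + 1 : ℕ) : ℤ)) * n + q + (((N + 1 : ℕ) : ℤ)) * R') (xCoreB n ℓ h R' (N + 1))) ∧
      LLO 0 ≤ coarse c₀ (D / 2) D (lam0 A vα vβ yT) +
        (c₀ * (A * (modulus n h vα vβ * (min (τ * ((((N + 1 : ℕ) : ℤ)) * n - q - (((N + 1 : ℕ) : ℤ)) * R')) (τ * ((((N + 1 : ℕ) : ℤ)) * n + q + (((N + 1 : ℕ) : ℤ)) * R'))) -
          max (vα * ((shearUnit n h : ℤ) * (min (τ * -xCoreB n ℓ h R' (N + 1)) (τ * xCoreB n ℓ h R' (N + 1)) - 1))) (vα * ((shearUnit n h : ℤ) * (max (τ * -xCoreB n ℓ h R' (N + 1)) (τ * xCoreB n ℓ h R' (N + 1))) + shearUnit n h - 1))) / n)) / D ∧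
      coarse c₀ (D / 2) D (lam0 A vα vβ yT) +
        (c₀ * (A * (modulus n h vα vβ * (max (τ * ((((N + 1 : ℕ) : ℤ)) * n - q - (((N + 1 : ℕ) : ℤ)) * R')) (τ * ((((N + 1 : ℕ) : ℤ)) * n + q + (((N + 1 : ℕ) : ℤ)) * R'))) -
          min (vα * ((shearUnit n h : ℤ) * (min (τ * -xCoreB n ℓ h R' (N + 1)) (τ * xCoreB n ℓ h R' (N + 1)) - 1))) (vα * ((shearUnit n h : ℤ) * (max (τ * -xCoreB n ℓ h R' (N + 1)) (τ * xCoreB n ℓ h R' (N + 1))) + shearUnit n h - 1))) / n)) / D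
        + 1 ≤ LHI 0 ∧
      LLO 1 ≤ coarse c₁ (D / 2) D (lam1 A n h yT) + (c₁ * (A * ((shearUnit n h : ℤ) * (min (τ * -xCoreB n ℓ h R' (N + 1)) (τ * xCoreB n ℓ h R' (N + 1)) - 1)))) / D ∧
      coarse c₁ (D / 2) D (lam1 A n h yT) + (c₁ * (A * ((shearUnit n h : ℤ) * (max (τ * -xCoreB n ℓ h R' (N + 1)) (τ * xCoreB n ℓ h R' (N + 1))) + shearUnit n h - 1))) / D + 1 ≤ LHI 1 ∧
      (∀ i, cen' i - b₀ i + 2 ≤ LLO i + z i) ∧ (∀ i, LHI i + z i ≤ cen' i + b₀ i - 2) := by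
  set f₀ := coarse c₀ (D / 2) D (lam0 A vα vβ yT) with hf₀
  set f₁ := coarse c₁ (D / 2) D (lam1 A n h yT) with hf₁
  set U : ℤ := (shearUnit n h : ℤ) with hU
  have hU1 : 1 ≤ U := by rw [hU]; exact_mod_cast (show 1 ≤ shearUnit n h by unfold shearUnit; omega)
  have hn0 : (0 : ℤ) < n := by exact_mod_cast hn
  have hnm : 0 < (n : ℤ) * mod := mul_pos hn0 hmod0
  set K : ℤ := ((N + 1 : ℕ) : ℤ) with hK
  set aLc : ℤ := K * n - q - K * R' with haLc
  set aHc : ℤ := K * n + q + K * R' with haHc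
  set B : ℤ := xCoreB n ℓ h R' (N + 1) with hB
  have hB0 : 0 ≤ B := by rw [hB]; unfold xCoreB; positivity
  have hmb : min (τ * -B) (τ * B) = -B := by
    rcases hτ with h1 | h1
    · rw [h1, one_mul, one_mul]; exact min_eq_left (by linarith)
    · rw [h1, neg_one_mul, neg_one_mul, neg_neg]; exact min_eq_right (by linarith)
  have hMb : max (τ * -B) (τ * B) = B := by
    rcases hτ with h1 | h1
    · rw [h1, one_mul, one_mul]; exact max_eq_right (by linarith)
    · rw [h1, neg_one_mul, neg_one_mul, neg_neg]; exact max_eq_left (by linarith)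
  have hcore : (xRunSched n ℓ h R' q N).core (N + 1) ⊆ Finset.Icc (pt aLc (-B)) (pt aHc B) := by
    have := xRunSched_core_subset n ℓ h R' q N (N + 1)
    simp only [xCoreB] at hB
    rw [haLc, haHc, hB, hK]
    convert this using 3
  let X0lo : ℤ := (c₀ * (A * (modulus n h vα vβ * (min (τ * aLc) (τ * aHc)) -
      max (vα * (U * (min (τ * -B) (τ * B) - 1))) (vα * (U * (max (τ * -B) (τ * B)) + U - 1))) / n)) / D
  let X0hi : ℤ := (c₀ * (A * (modulus n h vα vβ * (max (τ * aLc) (τ * aHc)) -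
      min (vα * (U * (min (τ * -B) (τ * B) - 1))) (vα * (U * (max (τ * -B) (τ * B)) + U - 1))) / n)) / D
  let X1lo : ℤ := (c₁ * (A * (U * (min (τ * -B) (τ * B) - 1)))) / D
  let X1hi : ℤ := (c₁ * (A * (U * (max (τ * -B) (τ * B)) + U - 1))) / D
  have hlo0 := (read0_lo_bounds (U := U) hA hκ₀ hmod0 hn0 hc0 hD hv hU1 hB0 (min (τ * aLc) (τ * aHc))).1
  have hhi0 := (read0_hi_bounds (U := U) hA hκ₀ hmod0 hn0 hc0 hD hv hU1 hB0 (max (τ * aLc) (τ * aHc))).2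
  have hlo1 := (read1_lo_bounds (U := U) (κ₁ := κ₁) hA hmod0 hc1 hD B).1
  have hhi1 := (read1_hi_bounds (U := U) (κ₁ := κ₁) hA hmod0 hc1 hD B).2
  simp only [xCSLo, xCSHi, ← hK] at FL1 FL2
  rw [← haLc, ← haHc] at FL1 FL2
  refine ⟨pt (f₀ + X0lo) (f₁ + X1lo), pt (f₀ + X0hi + 1) (f₁ + X1hi + 1), hcore,
    le_of_eq (pt_zero _ _), le_of_eq (pt_zero _ _).symm, le_of_eq (pt_one _ _), le_of_eq (pt_one _ _).symm, ?_, ?_⟩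
  · intro i; fin_cases i
    · show cen' 0 - b₀ 0 + 2 ≤ (pt (f₀ + X0lo) (f₁ + X1lo)) 0 + z 0
      rw [pt_zero]
      have e : X0lo = (c₀ * (A * (mod * (min (τ * aLc) (τ * aHc)) - max (vα * (U * (-B - 1))) (vα * (U * B + U - 1))) / n)) / D := by
        simp only [X0lo, hmod, hmb, hMb]
      have : cen' 0 - b₀ 0 + 2 - z 0 ≤ f₀ + X0lo := by rw [e]; exact le_of_mul_le_mul_left (by linarith) hnm
      linarith
    · show cen' 1 - b₀ 1 + 2 ≤ (pt (f₀ + X0lo) (f₁ + X1lo)) 1 + z 1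
      rw [pt_one]
      have e : X1lo = (c₁ * (A * (U * (-B - 1)))) / D := by simp only [X1lo, hmb]
      have : cen' 1 - b₀ 1 + 2 - z 1 ≤ f₁ + X1lo := by rw [e]; exact le_of_mul_le_mul_left (by linarith) hmod0
      linarith
  · intro i; fin_cases i
    · show (pt (f₀ + X0hi + 1) (f₁ + X1hi + 1)) 0 + z 0 ≤ cen' 0 + b₀ 0 - 2
      rw [pt_zero]
      have e : X0hi = (c₀ * (A * (mod * (max (τ * aLc) (τ * aHc)) - min (vα * (U * (-B - 1))) (vα * (U * B + U - 1))) / n)) / D := by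
        simp only [X0hi, hmod, hmb, hMb]
      have : f₀ + X0hi + 1 ≤ cen' 0 + b₀ 0 - 2 - z 0 := by rw [e]; exact le_of_mul_le_mul_left (by linarith) hnm
      linarith
    · show (pt (f₀ + X0hi + 1) (f₁ + X1hi + 1)) 1 + z 1 ≤ cen' 1 + b₀ 1 - 2
      rw [pt_one]
      have e : X1hi = (c₁ * (A * (U * B + U - 1))) / D := by simp only [X1hi, hMb]
      have : f₁ + X1hi + 1 ≤ cen' 1 + b₀ 1 - 2 - z 1 := by rw [e]; exact le_of_mul_le_mul_left (by linarith) hmod0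
      linarith

end Skelφ

end Summit.CriticalPhenomena.PercolationContinuityZ3.Theorems.Transplant
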